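import Summits.NavierStokesRegularity.NavierStokesRegularity.Theorems.LerayQuarterDissipationFiniteDissipationLiouvilleFinalTrace
import HarnessLib

/-!
# Crux `FiniteDissipationLiouville` (stmt-NavierStokesRegularity-22144): the trace of a past-DSS member
# is DSS-homogeneous (it is the homogeneous final datum of the lead-g2 residue)

Theorems file of route `LerayQuarterDissipation` (lead prover g3; `--supports` the crux). Navier–Stokes
regularity is NOT proved by anything here; no summit is.

For a field `u` which is `c`-DSS on the past, `c • u (c² t) (c • x) = u t x` (`t < 0`), the pairings
with a test field `φ` and with its dilate `φ(c⁻¹ ·)` are related slice by slice by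
`∫ ⟪u(t), φ⟫ = c⁻² ∫ ⟪u(c²t), φ(c⁻¹ ·)⟫` (`integral_pairing_pastDss`); hence the trace values at the
apex satisfy `L(φ) = c⁻² L(φ(c⁻¹ ·))` (`trace_pastDss_homogeneous`), i.e. the distributional trace
`u₀ = u(0⁻)` is `c`-DSS-homogeneous, `c u₀(c ·) = u₀` in `𝒟'(ℝ³)`: on the past-DSS members of the
stratum the trace of `…FinalTrace` IS the homogeneous final datum whose vanishing is the residue of
Bradshaw–Tsai's OP 5.1 on `𝒟` (lead g2, `…BlowdownLeaf`, `…MassLeaf`, `…FarFieldLeaf`).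

References: D. Chae, J. Wolf, arXiv:1610.09464, §1 (1.6)–(1.8); Z. Bradshaw, T.-P. Tsai, Ann. Henri
Poincaré 18 (2017), §5 (the DSS final data).
-/

noncomputable section

-- the summit and its single sub-problem share the name (CONVENTIONS §1), as in every Theorems file
set_option linter.dupNamespace false

namespace Summit.NavierStokesRegularity.NavierStokesRegularity.Theorems.FiniteDissipationLiouville.Birth.Apex

open MeasureTheory Set Filter Topology Metric Function TopologicalSpace
open Literature.Analysis Literature.Analysis.FluidPDE
open scoped ENNReal NNReal RealInnerProductSpace

variable {u : ℝ → EuclideanSpace ℝ (Fin 3) → EuclideanSpace ℝ (Fin 3)}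

/-- **Slice identity for a past-DSS field**: `∫ ⟪u(t), φ⟫ = c⁻² ∫ ⟪u(c²t), φ(c⁻¹ ·)⟫` for `t < 0`
(the self-similarity and the change of variables `x ↦ c x`, Jacobian `c³`). -/
theorem integral_pairing_pastDss {c : ℝ} (hc : 1 < c)
    (hdss : ∀ t : ℝ, t < 0 → ∀ x, c • u (c ^ 2 * t) (c • x) = u t x)
    (φ : EuclideanSpace ℝ (Fin 3) → EuclideanSpace ℝ (Fin 3)) {t : ℝ} (ht : t < 0) :
    ∫ x, ⟪u t x, φ x⟫ = (c ^ 2)⁻¹ * ∫ y, ⟪u (c ^ 2 * t) y, φ (c⁻¹ • y)⟫ := by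
  have hc0 : 0 < c := by linarith
  have hcne : c ≠ 0 := hc0.ne'
  -- rewrite the slice through the self-similarity and undo the dilation
  set f : EuclideanSpace ℝ (Fin 3) → ℝ := fun y => ⟪c • u (c ^ 2 * t) y, φ (c⁻¹ • y)⟫ with hf
  have h1 : (fun x => ⟪u t x, φ x⟫) = fun x => f (c • x) := by
    funext x
    simp only [hf, smul_smul, inv_mul_cancel₀ hcne, one_smul, hdss t ht x]
  rw [h1, Measure.integral_comp_smul volume f c]
  have hdet : |(c ^ Module.finrank ℝ (EuclideanSpace ℝ (Fin 3)))⁻¹| = (c ^ 3)⁻¹ := by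
    rw [finrank_euclideanSpace_fin, abs_inv, abs_of_pos (pow_pos hc0 3)]
  rw [hdet, smul_eq_mul]
  have h2 : ∫ y, f y = c * ∫ y, ⟪u (c ^ 2 * t) y, φ (c⁻¹ • y)⟫ := by
    simp only [hf, inner_smul_left, RCLike.conj_to_real]
    exact integral_const_mul c _
  rw [h2]
  field_simp

/-- **The trace of a past-DSS member is DSS-homogeneous.** If `u` is `c`-DSS on the past and the
pairings `∫⟪u(t), φ⟫`, `∫⟪u(t), φ(c⁻¹ ·)⟫` have trace values `L`, `L'` as `t → 0⁻`, then
`L = c⁻² L'`: the distributional trace `u₀` satisfies `c u₀(c ·) = u₀` in `𝒟'(ℝ³)`. -/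
theorem trace_pastDss_homogeneous {c : ℝ} (hc : 1 < c)
    (hdss : ∀ t : ℝ, t < 0 → ∀ x, c • u (c ^ 2 * t) (c • x) = u t x)
    {φ : EuclideanSpace ℝ (Fin 3) → EuclideanSpace ℝ (Fin 3)} {L L' : ℝ}
    (hL : Tendsto (fun t => ∫ x, ⟪u t x, φ x⟫) (𝓝[<] 0) (𝓝 L))
    (hL' : Tendsto (fun t => ∫ y, ⟪u t y, φ (c⁻¹ • y)⟫) (𝓝[<] 0) (𝓝 L')) :
    L = (c ^ 2)⁻¹ * L' := by
  have hc0 : 0 < c := by linarith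
  have hc2 : 0 < c ^ 2 := by positivity
  -- `t ↦ c² t` maps `𝓝[<] 0` to itself
  have hmap : Tendsto (fun t : ℝ => c ^ 2 * t) (𝓝[<] 0) (𝓝[<] 0) := by
    refine tendsto_nhdsWithin_of_tendsto_nhds_of_eventually_within _ ?_ ?_
    · have h : Tendsto (fun t : ℝ => c ^ 2 * t) (𝓝 0) (𝓝 (c ^ 2 * 0)) :=
        ((continuous_const_mul (c ^ 2)).tendsto 0)
      rw [mul_zero] at h
      exact h.mono_left nhdsWithin_le_nhds
    · filter_upwards [self_mem_nhdsWithin] with s hs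
      show c ^ 2 * s < 0
      have hs' : s < 0 := hs
      exact mul_neg_of_pos_of_neg hc2 hs'
  have h2 : Tendsto (fun t => (c ^ 2)⁻¹ * ∫ y, ⟪u (c ^ 2 * t) y, φ (c⁻¹ • y)⟫) (𝓝[<] 0)
      (𝓝 ((c ^ 2)⁻¹ * L')) :=
    (hL'.comp hmap).const_mul _
  have h3 : Tendsto (fun t => ∫ x, ⟪u t x, φ x⟫) (𝓝[<] 0) (𝓝 ((c ^ 2)⁻¹ * L')) := by
    refine h2.congr' ?_
    filter_upwards [self_mem_nhdsWithin] with t ht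
    exact (integral_pairing_pastDss hc hdss φ ht).symm
  exact tendsto_nhds_unique hL h3

end Summit.NavierStokesRegularity.NavierStokesRegularity.Theorems.FiniteDissipationLiouville.Birth.Apex

end
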